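import Literature.Geometry.Symplectic.SphereCROperatorJet
import Literature.Analysis.Complex.RiemannSphereDbar
import Literature.Analysis.FunctionSpaces.ContDiffHolderFDerivCLM
import Literature.Analysis.FunctionSpaces.ContDiffHolderDiffOperator
import Literature.Analysis.FunctionSpaces.ContDiffHolderNemytskii
import Literature.Analysis.FunctionSpaces.ContDiffHolderClosedGraph
import Literature.Analysis.FunctionSpaces.ContDiffHolderLocalization
import Mathlib.Topology.Algebra.Module.FiniteDimension
import HarnessLib

/-!
# The 1-jet maps of Hölder section pairs

Layer B4b (jet part) of the analytic core of the Hofer–Lizan–Sikorav local-foliation theorem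
(Wendl 2018, Thm. 2.46 / Prop. 2.53), as used by the lead of crux `WitnessCharge` (summit
`SmoothPoincare4`). The nonlinear Cauchy–Riemann operator of a sphere near the zero section of
`ℂℙ¹ × ℂ` is, in chart `i`, the smooth jet function `jetOp_i` of
`Literature/Geometry/Symplectic/SphereCROperatorJet.lean` composed with the **1-jet**
`z ↦ (z, ξ_i z, Dξ_i(z), f_i z, Df_i(z)) ∈ Jet` of the unknown pair `y = (ξ, f)` (a vector field,
clutching `τ w = -w²`, and a function, clutching `τ = 1`, both Hölder sections over the Riemann
sphere, `Literature/Analysis/Complex/RiemannSphereHolderSections.lean`). This file packages the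
1-jet as a **bounded affine map of Banach spaces**

  `jets₀ hr k : SecPair k r → C^{k,r}_b(ℂ, Jet)`, `jets₀ hr k y = zCutJet + jets₀CLM hr k y`,

so that the operator becomes a Nemytskii operator (`ContDiffHolderNemytskii.lean`) of the jet:

* `SphereCR.prodMkCLM` — pairing `C^{k,r}_b(E, F) × C^{k,r}_b(E, G) →L C^{k,r}_b(E, F × G)`;
* `SphereCR.zCutFun`, `zCutJet` — the compactly supported smooth coordinate `z ↦ ρ₄(z) z`
  (`= z` on `‖z‖ ≤ 4`) and the constant part `z ↦ (ρ₄(z) z, 0, 0, 0, 0)` of the jet;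
* `SphereCR.jets₀CLM`, `jets₀` (chart `z`) and `jets₁CLM`, `jets₁` (chart `w`) — the linear part
  `y ↦ (0, ξ_i, Dξ_i, f_i, Df_i)` built from the cut-off chart representatives `cutSec₀CLM`,
  `cutSec₁CLM` (`RiemannSphereDbar.lean`), the order-reduction `inclCLM` and the derivative
  `fderivCLM`; pointwise formulas (`jets₀_apply`, and on the disc `‖z‖ < 4` the honest jet of the
  representatives, `jets₀_apply_of_norm_lt`), the derivative (`hasFDerivAt_jets₀`), smoothness
  (`contDiff_jets₀`) and the value at `0` (`jets₀_zero`, `jets₀_zero_apply_of_norm_lt`).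

Everything is proved; no named facts. `Jet` is finite-dimensional and complete (checked below),
as the Nemytskii theorem requires.

## References

* C. Wendl, *Holomorphic Curves in Low Dimensions*, LNM 2216 (2018), §2.3, Thm. 2.46. [Wendl2018]
* D. Gilbarg, N. S. Trudinger, *Elliptic Partial Differential Equations of Second Order* (2001),
  §4.1. [GilbargTrudinger2001]
-/

noncomputable section

open Set Filter Metric Function Complex
open scoped Topology NNReal ContDiff
open Literature.Analysis.FunctionSpaces Literature.Analysis.Complex.RiemannSphere

namespace Literature.Geometry.Symplectic

namespace SphereCR

/-! ### The jet space is a finite-dimensional Banach space -/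

-- `Jet = ℂ × ℂ × (ℂ →L[ℝ] ℂ) × ℂ × (ℂ →L[ℝ] ℂ)`: products of complete / finite-dimensional spaces
-- (`ContinuousLinearMap.instModuleFinite` for the operator factors); all found by instance search.
example : CompleteSpace Jet := inferInstance
example : FiniteDimensional ℝ Jet := inferInstance
example (k : ℕ) (r : ℝ≥0) : CompleteSpace (ContDiffHolderFunction ℂ Jet k r) := inferInstance

/-! ### Pairing of Hölder functions as a bounded operator -/

section ProdMk

variable {E F G : Type*} [NormedAddCommGroup E] [NormedSpace ℝ E] [NormedAddCommGroup F]
  [NormedSpace ℝ F] [NormedAddCommGroup G] [NormedSpace ℝ G] {k : ℕ} {r : ℝ≥0}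

/-- The pair `(u, v) ∈ C^{k,r}_b(E, F × G)` of `u ∈ C^{k,r}_b(E, F)`, `v ∈ C^{k,r}_b(E, G)`.
[folklore] -/
def prodMkFun (p : ContDiffHolderFunction E F k r × ContDiffHolderFunction E G k r) :
    ContDiffHolderFunction E (F × G) k r :=
  ⟨fun x => (p.1 x, p.2 x), p.1.memContDiffHolder.prodMk p.2.memContDiffHolder⟩

/-- Pointwise: `prodMkFun p x = (p.1 x, p.2 x)`. [folklore] -/
@[simp]
theorem prodMkFun_apply (p : ContDiffHolderFunction E F k r × ContDiffHolderFunction E G k r)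
    (x : E) : prodMkFun p x = (p.1 x, p.2 x) := rfl

/-- Pairing as a linear map. [folklore] -/
def prodMkₗ : ContDiffHolderFunction E F k r × ContDiffHolderFunction E G k r →ₗ[ℝ]
    ContDiffHolderFunction E (F × G) k r where
  toFun := prodMkFun
  map_add' p q := ContDiffHolderFunction.ext fun x => by simp
  map_smul' c p := ContDiffHolderFunction.ext fun x => by simp

/-- `‖(u, v)‖_{k,r} ≤ 2 ‖(u, v)‖` (`≤ ‖u‖ + ‖v‖`, `norm_prodMk_le`). [folklore] -/
theorem norm_prodMkFun_le (p : ContDiffHolderFunction E F k r × ContDiffHolderFunction E G k r) :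
    ‖prodMkFun p‖ ≤ 2 * ‖p‖ :=
  (ContDiffHolderFunction.norm_prodMk_le p.1 p.2).trans
    (by linarith [norm_fst_le p, norm_snd_le p])

/-- **Pairing is a bounded operator** `C^{k,r}_b(E, F) × C^{k,r}_b(E, G) →L[ℝ] C^{k,r}_b(E, F × G)`.
[folklore] -/
def prodMkCLM : ContDiffHolderFunction E F k r × ContDiffHolderFunction E G k r →L[ℝ]
    ContDiffHolderFunction E (F × G) k r :=
  prodMkₗ.mkContinuous 2 norm_prodMkFun_le

/-- Pointwise: `prodMkCLM p x = (p.1 x, p.2 x)`. [folklore] -/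
@[simp]
theorem prodMkCLM_apply (p : ContDiffHolderFunction E F k r × ContDiffHolderFunction E G k r)
    (x : E) : prodMkCLM p x = (p.1 x, p.2 x) := rfl

end ProdMk

/-! ### The cut-off coordinate function -/

section ZCut

variable (k : ℕ) (r : ℝ≥0)

/-- `z ↦ ρ₄(z) z` is smooth. [folklore] -/
theorem contDiff_rhoCut₄_mul_id : ContDiff ℝ ∞ fun z : ℂ => (rhoCut₄ z : ℂ) * z :=
  (ofRealCLM.contDiff.comp contDiff_rhoCut₄).mul contDiff_id

/-- `z ↦ ρ₄(z) z` has compact support. [folklore] -/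
theorem hasCompactSupport_rhoCut₄_mul_id : HasCompactSupport fun z : ℂ => (rhoCut₄ z : ℂ) * z :=
  (hasCompactSupport_rhoCut₄.comp_left ofReal_zero).mul_right

/-- **The cut-off coordinate** `zCutFun : z ↦ ρ₄(z) z` as a member of `C^{k,r}_b(ℂ, ℂ)`
(smooth with compact support; `= z` on `‖z‖ ≤ 4`). [folklore] -/
def zCutFun (hr : r ≤ 1) : ContDiffHolderFunction ℂ ℂ k r :=
  ⟨fun z => (rhoCut₄ z : ℂ) * z, MemContDiffHolder.of_contDiff_of_hasCompactSupport
    contDiff_rhoCut₄_mul_id hasCompactSupport_rhoCut₄_mul_id hr⟩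

/-- Pointwise: `zCutFun z = ρ₄(z) z`. [folklore] -/
@[simp]
theorem zCutFun_apply (hr : r ≤ 1) (z : ℂ) : zCutFun k r hr z = (rhoCut₄ z : ℂ) * z := rfl

/-- On the disc `‖z‖ ≤ 4`, `zCutFun z = z`. [folklore] -/
theorem zCutFun_apply_of_norm_le (hr : r ≤ 1) {z : ℂ} (hz : ‖z‖ ≤ 4) : zCutFun k r hr z = z := by
  rw [zCutFun_apply, rhoCut₄_eq_one hz, ofReal_one, one_mul]

/-- **The constant part of the jet**: `z ↦ (ρ₄(z) z, 0, 0, 0, 0) ∈ C^{k,r}_b(ℂ, Jet)`. [folklore] -/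
def zCutJet (hr : r ≤ 1) : ContDiffHolderFunction ℂ Jet k r :=
  prodMkCLM (zCutFun k r hr, (0 : ContDiffHolderFunction ℂ (ℂ × (ℂ →L[ℝ] ℂ) × ℂ × (ℂ →L[ℝ] ℂ)) k r))

/-- Pointwise: `zCutJet z = (ρ₄(z) z, 0, 0, 0, 0)`. [folklore] -/
@[simp]
theorem zCutJet_apply (hr : r ≤ 1) (z : ℂ) :
    zCutJet k r hr z = ((rhoCut₄ z : ℂ) * z, 0, 0, 0, 0) := rfl

/-- On the disc `‖z‖ ≤ 4`, `zCutJet z = (z, 0, 0, 0, 0)`. [folklore] -/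
theorem zCutJet_apply_of_norm_le (hr : r ≤ 1) {z : ℂ} (hz : ‖z‖ ≤ 4) :
    zCutJet k r hr z = (z, 0, 0, 0, 0) := by
  rw [zCutJet_apply, rhoCut₄_eq_one hz, ofReal_one, one_mul]

end ZCut

/-! ### The two clutching functions -/

/-- The tangent clutching `τ w = -w²` is real-smooth off the origin. [folklore] -/
theorem contDiffOn_neg_sq_clutch : ContDiffOn ℝ ∞ (fun w : ℂ => -w ^ 2) {w | w ≠ 0} :=
  contDiffOn_real_of_differentiableOn differentiableOn_neg_sq_clutch

/-- The trivial clutching `τ = 1` is real-smooth off the origin. [folklore] -/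
theorem contDiffOn_one_clutch : ContDiffOn ℝ ∞ (1 : ℂ → ℂ) {w | w ≠ 0} :=
  contDiffOn_real_of_differentiableOn differentiableOn_one_clutch

/-- **The space of unknowns**: pairs `y = (ξ, f)` of a Hölder vector field (clutching `-w²`) and a
Hölder function (clutching `1`) of class `C^{k+1,r}` over the Riemann sphere.
[cite: Wendl2018, Thm. 2.46] -/
abbrev SecPair (k : ℕ) (r : ℝ≥0) : Type :=
  holderSections ℂ (fun w : ℂ => -w ^ 2) (k + 1) r × holderSections ℂ (1 : ℂ → ℂ) (k + 1) r

section Jets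

variable {r : ℝ≥0} (hr : r ≤ 1) (k : ℕ)

/-! ### The jet map in the chart `z` -/

/-- **The linear part of the `z`-jet**:
`(ξ, f) ↦ (0, ξ₀, Dξ₀, f₀, Df₀)` with `ξ₀ = cutSec₀CLM ξ`, `f₀ = cutSec₀CLM f` the cut-off
`z`-representatives, a bounded operator `SecPair k r →L[ℝ] C^{k,r}_b(ℂ, Jet)`.
[cite: Wendl2018, Thm. 2.46] -/
def jets₀CLM : SecPair k r →L[ℝ] ContDiffHolderFunction ℂ Jet k r :=
  prodMkCLM.comp ((0 : SecPair k r →L[ℝ] ContDiffHolderFunction ℂ ℂ k r).prod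
    (prodMkCLM.comp (((ContDiffHolderFunction.inclCLM hr).comp
      ((cutSec₀CLM neg_sq_clutch_ne_zero contDiffOn_neg_sq_clutch hr).comp
        (ContinuousLinearMap.fst ℝ _ _))).prod
    (prodMkCLM.comp ((ContDiffHolderFunction.fderivCLM.comp
      ((cutSec₀CLM neg_sq_clutch_ne_zero contDiffOn_neg_sq_clutch hr).comp
        (ContinuousLinearMap.fst ℝ _ _))).prod
    (prodMkCLM.comp (((ContDiffHolderFunction.inclCLM hr).comp
      ((cutSec₀CLM one_clutch_ne_zero contDiffOn_one_clutch hr).comp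
        (ContinuousLinearMap.snd ℝ _ _))).prod
    (ContDiffHolderFunction.fderivCLM.comp
      ((cutSec₀CLM one_clutch_ne_zero contDiffOn_one_clutch hr).comp
        (ContinuousLinearMap.snd ℝ _ _))))))))))

/-- Pointwise: `jets₀CLM y z = (0, ξ₀ z, Dξ₀(z), f₀ z, Df₀(z))` with `ξ₀ = cutSec₀CLM y.1`,
`f₀ = cutSec₀CLM y.2`. [folklore] -/
@[simp]
theorem jets₀CLM_apply (y : SecPair k r) (z : ℂ) :
    jets₀CLM hr k y z = (0, cutSec₀CLM neg_sq_clutch_ne_zero contDiffOn_neg_sq_clutch hr y.1 z,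
      fderiv ℝ (cutSec₀CLM neg_sq_clutch_ne_zero contDiffOn_neg_sq_clutch hr y.1 : ℂ → ℂ) z,
      cutSec₀CLM one_clutch_ne_zero contDiffOn_one_clutch hr y.2 z,
      fderiv ℝ (cutSec₀CLM one_clutch_ne_zero contDiffOn_one_clutch hr y.2 : ℂ → ℂ) z) := rfl

/-- **The `z`-jet map** `jets₀ y = zCutJet + jets₀CLM y : SecPair k r → C^{k,r}_b(ℂ, Jet)`, a
bounded affine map; on `‖z‖ < 4` its value at `z` is the 1-jet
`(z, ξ₀ z, Dξ₀(z), f₀ z, Df₀(z))` of the `z`-representatives (`jets₀_apply_of_norm_lt`).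
[cite: Wendl2018, Thm. 2.46] -/
def jets₀ (y : SecPair k r) : ContDiffHolderFunction ℂ Jet k r :=
  zCutJet k r hr + jets₀CLM hr k y

/-- Unfolding: `jets₀ y = zCutJet + jets₀CLM y`. [folklore] -/
theorem jets₀_def (y : SecPair k r) : jets₀ hr k y = zCutJet k r hr + jets₀CLM hr k y := rfl

/-- Pointwise: `jets₀ y z = (ρ₄(z) z, ξ₀ z, Dξ₀(z), f₀ z, Df₀(z))` with the cut-off
representatives `ξ₀ = cutSec₀CLM y.1`, `f₀ = cutSec₀CLM y.2`. [folklore] -/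
theorem jets₀_apply (y : SecPair k r) (z : ℂ) :
    jets₀ hr k y z = ((rhoCut₄ z : ℂ) * z,
      cutSec₀CLM neg_sq_clutch_ne_zero contDiffOn_neg_sq_clutch hr y.1 z,
      fderiv ℝ (cutSec₀CLM neg_sq_clutch_ne_zero contDiffOn_neg_sq_clutch hr y.1 : ℂ → ℂ) z,
      cutSec₀CLM one_clutch_ne_zero contDiffOn_one_clutch hr y.2 z,
      fderiv ℝ (cutSec₀CLM one_clutch_ne_zero contDiffOn_one_clutch hr y.2 : ℂ → ℂ) z) := by
  rw [jets₀_def, ContDiffHolderFunction.coe_add, Pi.add_apply, zCutJet_apply, jets₀CLM_apply]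
  simp only [Prod.mk_add_mk, add_zero, zero_add]

/-- **The `z`-jet on the disc `‖z‖ < 4` is the honest 1-jet of the `z`-representatives**:
`jets₀ y z = (z, sec₀ ξ z, D(sec₀ ξ)(z), sec₀ f z, D(sec₀ f)(z))` (the cutoff `ρ₄` is `1` on a
neighbourhood of `z`, and `fderiv` is local). [cite: Wendl2018, Thm. 2.46] -/
theorem jets₀_apply_of_norm_lt (y : SecPair k r) {z : ℂ} (hz : ‖z‖ < 4) :
    jets₀ hr k y z = (z,
      sec₀ (fun w : ℂ => -w ^ 2) (y.1 : ContDiffHolderFunction ℂ ℂ (k + 1) r ×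
        ContDiffHolderFunction ℂ ℂ (k + 1) r) z,
      fderiv ℝ (sec₀ (fun w : ℂ => -w ^ 2) (y.1 : ContDiffHolderFunction ℂ ℂ (k + 1) r ×
        ContDiffHolderFunction ℂ ℂ (k + 1) r)) z,
      sec₀ 1 (y.2 : ContDiffHolderFunction ℂ ℂ (k + 1) r × ContDiffHolderFunction ℂ ℂ (k + 1) r) z,
      fderiv ℝ (sec₀ 1 (y.2 : ContDiffHolderFunction ℂ ℂ (k + 1) r ×
        ContDiffHolderFunction ℂ ℂ (k + 1) r)) z) := by
  have hU : {x : ℂ | ‖x‖ < 4} ∈ 𝓝 z := (isOpen_lt continuous_norm continuous_const).mem_nhds hz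
  have hev₁ : ((cutSec₀CLM neg_sq_clutch_ne_zero contDiffOn_neg_sq_clutch hr y.1 :
      ContDiffHolderFunction ℂ ℂ (k + 1) r) : ℂ → ℂ) =ᶠ[𝓝 z]
        sec₀ (fun w : ℂ => -w ^ 2) (y.1 : ContDiffHolderFunction ℂ ℂ (k + 1) r ×
          ContDiffHolderFunction ℂ ℂ (k + 1) r) := by
    filter_upwards [hU] with x hx
    exact cutSec₀CLM_apply_of_norm_le _ _ hr y.1 (le_of_lt hx)
  have hev₂ : ((cutSec₀CLM one_clutch_ne_zero contDiffOn_one_clutch hr y.2 :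
      ContDiffHolderFunction ℂ ℂ (k + 1) r) : ℂ → ℂ) =ᶠ[𝓝 z]
        sec₀ 1 (y.2 : ContDiffHolderFunction ℂ ℂ (k + 1) r ×
          ContDiffHolderFunction ℂ ℂ (k + 1) r) := by
    filter_upwards [hU] with x hx
    exact cutSec₀CLM_apply_of_norm_le _ _ hr y.2 (le_of_lt hx)
  rw [jets₀_apply, rhoCut₄_eq_one hz.le, ofReal_one, one_mul,
    cutSec₀CLM_apply_of_norm_le _ _ hr y.1 hz.le, cutSec₀CLM_apply_of_norm_le _ _ hr y.2 hz.le,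
    hev₁.fderiv_eq, hev₂.fderiv_eq]

/-- **The `z`-jet map is affine**: its Fréchet derivative at every point is `jets₀CLM`.
[folklore] -/
theorem hasFDerivAt_jets₀ (y : SecPair k r) : HasFDerivAt (jets₀ hr k) (jets₀CLM hr k) y :=
  ((jets₀CLM hr k).hasFDerivAt).const_add (zCutJet k r hr)

/-- The Fréchet derivative of the `z`-jet map is `jets₀CLM`. [folklore] -/
theorem fderiv_jets₀ (y : SecPair k r) : fderiv ℝ (jets₀ hr k) y = jets₀CLM hr k :=
  (hasFDerivAt_jets₀ hr k y).fderiv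

/-- **The `z`-jet map is smooth** (affine and bounded). [folklore] -/
theorem contDiff_jets₀ {n : WithTop ℕ∞} : ContDiff ℝ n (jets₀ hr k) :=
  contDiff_const.add (jets₀CLM hr k).contDiff

/-- The `z`-jet map is continuous. [folklore] -/
theorem continuous_jets₀ : Continuous (jets₀ hr k) :=
  (contDiff_jets₀ hr k (n := 0)).continuous

/-- At the zero section the `z`-jet is the constant part: `jets₀ 0 = zCutJet`. [folklore] -/
theorem jets₀_zero : jets₀ hr k 0 = zCutJet k r hr := by
  rw [jets₀_def, map_zero, add_zero]

/-- At the zero section, on the disc `‖z‖ < 4`: `jets₀ 0 z = (z, 0, 0, 0, 0)`. [folklore] -/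
theorem jets₀_zero_apply_of_norm_lt {z : ℂ} (hz : ‖z‖ < 4) :
    jets₀ hr k 0 z = (z, 0, 0, 0, 0) := by
  rw [jets₀_zero, zCutJet_apply_of_norm_le k r hr hz.le]

/-- `jets₀ y - jets₀ y' = jets₀CLM (y - y')` (affine). [folklore] -/
theorem jets₀_sub (y y' : SecPair k r) : jets₀ hr k y - jets₀ hr k y' = jets₀CLM hr k (y - y') := by
  rw [jets₀_def, jets₀_def, map_sub]
  abel

/-! ### The jet map in the chart `w` -/

/-- **The linear part of the `w`-jet**:
`(ξ, f) ↦ (0, ξ₁, Dξ₁, f₁, Df₁)` with `ξ₁ = cutSec₁CLM ξ`, `f₁ = cutSec₁CLM f` the cut-off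
`w`-representatives, a bounded operator `SecPair k r →L[ℝ] C^{k,r}_b(ℂ, Jet)`.
[cite: Wendl2018, Thm. 2.46] -/
def jets₁CLM : SecPair k r →L[ℝ] ContDiffHolderFunction ℂ Jet k r :=
  prodMkCLM.comp ((0 : SecPair k r →L[ℝ] ContDiffHolderFunction ℂ ℂ k r).prod
    (prodMkCLM.comp (((ContDiffHolderFunction.inclCLM hr).comp
      ((cutSec₁CLM (τ := fun w : ℂ => -w ^ 2) contDiffOn_neg_sq_clutch hr).comp
        (ContinuousLinearMap.fst ℝ _ _))).prod
    (prodMkCLM.comp ((ContDiffHolderFunction.fderivCLM.comp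
      ((cutSec₁CLM (τ := fun w : ℂ => -w ^ 2) contDiffOn_neg_sq_clutch hr).comp
        (ContinuousLinearMap.fst ℝ _ _))).prod
    (prodMkCLM.comp (((ContDiffHolderFunction.inclCLM hr).comp
      ((cutSec₁CLM (τ := (1 : ℂ → ℂ)) contDiffOn_one_clutch hr).comp
        (ContinuousLinearMap.snd ℝ _ _))).prod
    (ContDiffHolderFunction.fderivCLM.comp
      ((cutSec₁CLM (τ := (1 : ℂ → ℂ)) contDiffOn_one_clutch hr).comp
        (ContinuousLinearMap.snd ℝ _ _))))))))))

/-- Pointwise: `jets₁CLM y w = (0, ξ₁ w, Dξ₁(w), f₁ w, Df₁(w))` with `ξ₁ = cutSec₁CLM y.1`,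
`f₁ = cutSec₁CLM y.2`. [folklore] -/
@[simp]
theorem jets₁CLM_apply (y : SecPair k r) (w : ℂ) :
    jets₁CLM hr k y w = (0, cutSec₁CLM contDiffOn_neg_sq_clutch hr y.1 w,
      fderiv ℝ (cutSec₁CLM contDiffOn_neg_sq_clutch hr y.1 : ℂ → ℂ) w,
      cutSec₁CLM contDiffOn_one_clutch hr y.2 w,
      fderiv ℝ (cutSec₁CLM contDiffOn_one_clutch hr y.2 : ℂ → ℂ) w) := rfl

/-- **The `w`-jet map** `jets₁ y = zCutJet + jets₁CLM y : SecPair k r → C^{k,r}_b(ℂ, Jet)`.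
[cite: Wendl2018, Thm. 2.46] -/
def jets₁ (y : SecPair k r) : ContDiffHolderFunction ℂ Jet k r :=
  zCutJet k r hr + jets₁CLM hr k y

/-- Unfolding: `jets₁ y = zCutJet + jets₁CLM y`. [folklore] -/
theorem jets₁_def (y : SecPair k r) : jets₁ hr k y = zCutJet k r hr + jets₁CLM hr k y := rfl

/-- Pointwise: `jets₁ y w = (ρ₄(w) w, ξ₁ w, Dξ₁(w), f₁ w, Df₁(w))` with the cut-off
representatives `ξ₁ = cutSec₁CLM y.1`, `f₁ = cutSec₁CLM y.2`. [folklore] -/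
theorem jets₁_apply (y : SecPair k r) (w : ℂ) :
    jets₁ hr k y w = ((rhoCut₄ w : ℂ) * w,
      cutSec₁CLM contDiffOn_neg_sq_clutch hr y.1 w,
      fderiv ℝ (cutSec₁CLM contDiffOn_neg_sq_clutch hr y.1 : ℂ → ℂ) w,
      cutSec₁CLM contDiffOn_one_clutch hr y.2 w,
      fderiv ℝ (cutSec₁CLM contDiffOn_one_clutch hr y.2 : ℂ → ℂ) w) := by
  rw [jets₁_def, ContDiffHolderFunction.coe_add, Pi.add_apply, zCutJet_apply, jets₁CLM_apply]
  simp only [Prod.mk_add_mk, add_zero, zero_add]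

/-- **The `w`-jet on the disc `‖w‖ < 4` is the honest 1-jet of the `w`-representatives**:
`jets₁ y w = (w, sec₁ ξ w, D(sec₁ ξ)(w), sec₁ f w, D(sec₁ f)(w))`. [cite: Wendl2018, Thm. 2.46] -/
theorem jets₁_apply_of_norm_lt (y : SecPair k r) {w : ℂ} (hw : ‖w‖ < 4) :
    jets₁ hr k y w = (w,
      sec₁ (fun w : ℂ => -w ^ 2) (y.1 : ContDiffHolderFunction ℂ ℂ (k + 1) r ×
        ContDiffHolderFunction ℂ ℂ (k + 1) r) w,
      fderiv ℝ (sec₁ (fun w : ℂ => -w ^ 2) (y.1 : ContDiffHolderFunction ℂ ℂ (k + 1) r ×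
        ContDiffHolderFunction ℂ ℂ (k + 1) r)) w,
      sec₁ 1 (y.2 : ContDiffHolderFunction ℂ ℂ (k + 1) r × ContDiffHolderFunction ℂ ℂ (k + 1) r) w,
      fderiv ℝ (sec₁ 1 (y.2 : ContDiffHolderFunction ℂ ℂ (k + 1) r ×
        ContDiffHolderFunction ℂ ℂ (k + 1) r)) w) := by
  have hU : {x : ℂ | ‖x‖ < 4} ∈ 𝓝 w := (isOpen_lt continuous_norm continuous_const).mem_nhds hw
  have hev₁ : ((cutSec₁CLM contDiffOn_neg_sq_clutch hr y.1 :
      ContDiffHolderFunction ℂ ℂ (k + 1) r) : ℂ → ℂ) =ᶠ[𝓝 w]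
        sec₁ (fun w : ℂ => -w ^ 2) (y.1 : ContDiffHolderFunction ℂ ℂ (k + 1) r ×
          ContDiffHolderFunction ℂ ℂ (k + 1) r) := by
    filter_upwards [hU] with x hx
    exact cutSec₁CLM_apply_of_norm_le _ hr y.1 (le_of_lt hx)
  have hev₂ : ((cutSec₁CLM contDiffOn_one_clutch hr y.2 :
      ContDiffHolderFunction ℂ ℂ (k + 1) r) : ℂ → ℂ) =ᶠ[𝓝 w]
        sec₁ 1 (y.2 : ContDiffHolderFunction ℂ ℂ (k + 1) r ×
          ContDiffHolderFunction ℂ ℂ (k + 1) r) := by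
    filter_upwards [hU] with x hx
    exact cutSec₁CLM_apply_of_norm_le _ hr y.2 (le_of_lt hx)
  rw [jets₁_apply, rhoCut₄_eq_one hw.le, ofReal_one, one_mul,
    cutSec₁CLM_apply_of_norm_le _ hr y.1 hw.le, cutSec₁CLM_apply_of_norm_le _ hr y.2 hw.le,
    hev₁.fderiv_eq, hev₂.fderiv_eq]

/-- **The `w`-jet map is affine**: its Fréchet derivative at every point is `jets₁CLM`.
[folklore] -/
theorem hasFDerivAt_jets₁ (y : SecPair k r) : HasFDerivAt (jets₁ hr k) (jets₁CLM hr k) y :=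
  ((jets₁CLM hr k).hasFDerivAt).const_add (zCutJet k r hr)

/-- The Fréchet derivative of the `w`-jet map is `jets₁CLM`. [folklore] -/
theorem fderiv_jets₁ (y : SecPair k r) : fderiv ℝ (jets₁ hr k) y = jets₁CLM hr k :=
  (hasFDerivAt_jets₁ hr k y).fderiv

/-- **The `w`-jet map is smooth** (affine and bounded). [folklore] -/
theorem contDiff_jets₁ {n : WithTop ℕ∞} : ContDiff ℝ n (jets₁ hr k) :=
  contDiff_const.add (jets₁CLM hr k).contDiff

/-- The `w`-jet map is continuous. [folklore] -/
theorem continuous_jets₁ : Continuous (jets₁ hr k) :=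
  (contDiff_jets₁ hr k (n := 0)).continuous

/-- At the zero section the `w`-jet is the constant part: `jets₁ 0 = zCutJet`. [folklore] -/
theorem jets₁_zero : jets₁ hr k 0 = zCutJet k r hr := by
  rw [jets₁_def, map_zero, add_zero]

/-- At the zero section, on the disc `‖w‖ < 4`: `jets₁ 0 w = (w, 0, 0, 0, 0)`. [folklore] -/
theorem jets₁_zero_apply_of_norm_lt {w : ℂ} (hw : ‖w‖ < 4) :
    jets₁ hr k 0 w = (w, 0, 0, 0, 0) := by
  rw [jets₁_zero, zCutJet_apply_of_norm_le k r hr hw.le]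

/-- `jets₁ y - jets₁ y' = jets₁CLM (y - y')` (affine). [folklore] -/
theorem jets₁_sub (y y' : SecPair k r) : jets₁ hr k y - jets₁ hr k y' = jets₁CLM hr k (y - y') := by
  rw [jets₁_def, jets₁_def, map_sub]
  abel

end Jets

end SphereCR

end Literature.Geometry.Symplectic

end
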